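import Mathlib.RepresentationTheory.Homological.ContCohomology.Functoriality
import Mathlib.Topology.ContinuousMap.Basic
import HarnessLib

/-!
# Continuous cohomology in degree one: cocycles are continuous crossed homomorphisms, and
# inflation along a quotient map is an isomorphism on `H¹` when the crossed homomorphisms kill
# the kernel

Generic infrastructure over Mathlib's `continuousCohomology` (homogeneous continuous cochains,
`Mathlib.RepresentationTheory.Homological.ContCohomology.*`, which at present identifies only
`H⁰` with the invariants).  Source of the statements: J.-P. Serre, *Cohomologie galoisienne* /
*Galois Cohomology*, I §2.3 "`H¹(G, A)` est le groupe des classes d'homomorphismes croisés continus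
de `G` dans `A`" together with the *Remarque* of I §2.3 that the same cochain formalism is used
for an arbitrary topological `G`-module `A` [cite: SerreGaloisCohomology1997, I §2.3]; and the
degree-one inflation statement (the injective part of the inflation–restriction sequence,
[cite: SerreGaloisCohomology1997, I §2.6 (b)]).

What is proved (all `theorem`s / constructions with bodies, no named facts):

* (used silently, by `rfl`: the first differentials of Mathlib's resolution `X → C(G, X) →
  C(G, C(G, X)) → …` evaluate to `(d f)(x)(y) = f y − f x` and
  `(d F)(x)(y)(z) = F y z − (F x z − F x y)`; as named lemmas these already live in the tree's
  `Literature/NumberTheory/EllipticCurves/Sha.lean`, not imported here to keep this file light.)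
* `cocycle_eq`, `crossedHom_mul`, `twoOf_row_eq`: a homogeneous continuous `1`-cocycle `F` (an
  invariant element of `C(G, C(G, X))` killed by `d`) is `F x y = f y − f x` (`= twoOf X f`) for the
  continuous CROSSED HOMOMORPHISM `f := F 1`, `f (x y) = f x + x • f y`; conversely (`d_twoOf`,
  `twoOf_mem_invariants`) every continuous crossed homomorphism gives an invariant cocycle.
* `isIso_cyclesMap_one`, `isIso_map_one_of_crossedHomsKillKer`: for a continuous homomorphism
  `φ : H → G` of topological groups
  which is a quotient map, with `H` compact and `G` Hausdorff, and a topological `G`-module `X`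
  such that EVERY continuous crossed homomorphism `H → X` (for the action through `φ`) vanishes on
  `Ker φ`, the inflation map `H¹(G, X) → H¹(H, X|_H)` (`ContinuousCohomology.map φ (𝟙 _) 1`) is an
  isomorphism in `TopModuleCat k` (bijective AND bicontinuous).  Route: Mathlib's
  `ShortComplex.isIso_homologyMap_of_isIso_cyclesMap_of_epi` — inflation is surjective on
  `0`-cochains and an isomorphism on `1`-cocycles, the inverse on cocycles being "descend the
  crossed homomorphism along `φ`" (`Topology.IsQuotientMap.lift`; continuity from compactness of
  `H` via the compact-open topology).

Cell abc-iut (layer L4) uses this to DISCHARGE [AbsCusp] Prop. 2.1 (i) (`AbsCusp.Prop_2_1_i`,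
`AbsCuspCohomology.lean`); the lemma is generic and carries no anabelian content.
-/

noncomputable section

open CategoryTheory TopRep ContRepresentation Topology

namespace ContinuousCohomology

universe u v w

variable {k : Type u} [Ring k] [TopologicalSpace k]
variable {G H : Type v} [Group G] [TopologicalSpace G] [IsTopologicalGroup G]
  [Group H] [TopologicalSpace H] [IsTopologicalGroup H]

/-! ### Homogeneous `1`-cocycles are continuous crossed homomorphisms -/

section Cocycles

variable {X : TopRep.{max v w} k G}

/-- A homogeneous `1`-cochain killed by `d` is determined by its row at `1`:
`F x y = F 1 y − F 1 x`. [cite: SerreGaloisCohomology1997, I §2.3] -/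
theorem cocycle_eq {F : C(G, C(G, X))} (hF : (d X 2).hom F = 0) (x y : G) :
    F x y = F 1 y - F 1 x := by
  have h := congrArg (fun Φ : C(G, C(G, C(G, X))) => Φ 1 x y) hF
  simp only [ContinuousMap.zero_apply] at h
  exact sub_eq_zero.1 h

/-- Its row at `1` vanishes at `1`. [cite: SerreGaloisCohomology1997, I §2.3] -/
theorem cocycle_one_one {F : C(G, C(G, X))} (hF : (d X 2).hom F = 0) : F 1 1 = 0 := by
  have h := cocycle_eq hF 1 1
  rwa [sub_self] at h

/-- The invariance of a homogeneous `1`-cochain under the (coinduced) `G`-action, evaluated: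
`g • F (g⁻¹ x) (g⁻¹ y) = F x y`. [cite: SerreGaloisCohomology1997, I §2.3] -/
theorem invariant_apply {F : C(G, C(G, X))} (hF : F ∈ (resolutionX X 2).ρ.invariants)
    (g x y : G) : X.ρ g (F (g⁻¹ * x) (g⁻¹ * y)) = F x y := by
  have h := congrArg (fun Φ : C(G, C(G, X)) => Φ x y) (hF g)
  exact h

/-- The row `f := F 1` of an invariant homogeneous `1`-cocycle is a CROSSED HOMOMORPHISM:
`f (x y) = f x + x • f y`. [cite: SerreGaloisCohomology1997, I §2.3] -/
theorem crossedHom_mul {F : C(G, C(G, X))} (hFi : F ∈ (resolutionX X 2).ρ.invariants)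
    (hFd : (d X 2).hom F = 0) (x y : G) : F 1 (x * y) = F 1 x + X.ρ x (F 1 y) := by
  have h1 := invariant_apply hFi x x (x * y)
  rw [inv_mul_cancel_left, inv_mul_cancel, cocycle_eq hFd x (x * y)] at h1
  rw [h1]
  abel

/-- "`f y − f x`": the homogeneous two-variable cochain attached to a one-variable continuous
function, as a continuous linear map `C(G, X) → C(G, C(G, X))`.
[cite: SerreGaloisCohomology1997, I §2.3] -/
def twoOf (X : TopRep.{max v w} k G) : C(G, X) →L[k] C(G, C(G, X)) where
  toFun f := ContinuousMap.const G f - ContinuousMap.const'.comp f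
  map_add' f g := by ext x y; simp; abel
  map_smul' c f := by ext x y; simp [smul_sub]
  cont := ContinuousMap.continuous_const'.sub (ContinuousMap.continuous_postcomp _)

omit [IsTopologicalGroup G] in
/-- `twoOf f x y = f y − f x`. [cite: SerreGaloisCohomology1997, I §2.3] -/
@[simp] theorem twoOf_apply (X : TopRep.{max v w} k G) (f : C(G, X)) (x y : G) :
    twoOf X f x y = f y - f x := rfl

/-- A continuous crossed homomorphism `f` gives an INVARIANT homogeneous cochain `twoOf f`.
[cite: SerreGaloisCohomology1997, I §2.3] -/
theorem twoOf_mem_invariants {f : C(G, X)} (hf : ∀ x y, f (x * y) = f x + X.ρ x (f y)) :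
    twoOf X f ∈ (resolutionX X 2).ρ.invariants := by
  intro g
  ext x y
  show X.ρ g (f (g⁻¹ * y) - f (g⁻¹ * x)) = f y - f x
  have hx := hf g (g⁻¹ * x)
  have hy := hf g (g⁻¹ * y)
  rw [mul_inv_cancel_left] at hx hy
  rw [map_sub, hx, hy]
  abel

/-- … which is a cocycle: `d (twoOf f) = 0`. [cite: SerreGaloisCohomology1997, I §2.3] -/
theorem d_twoOf (f : C(G, X)) : (d X 2).hom (twoOf X f) = 0 := by
  ext x y z
  show (f z - f y) - ((f z - f x) - (f y - f x)) = 0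
  abel

/-- Conversely an invariant homogeneous `1`-cocycle IS `twoOf` of its row at `1`.
[cite: SerreGaloisCohomology1997, I §2.3] -/
theorem twoOf_row_eq {F : C(G, C(G, X))} (hFd : (d X 2).hom F = 0) :
    twoOf X (F 1) = F := by
  ext x y
  rw [twoOf_apply, cocycle_eq hFd x y]

variable (X) in
/-- The invariant homogeneous `1`-cochain underlying a point of Mathlib's abstract cycles object
`Z¹(G, X)`. [cite: SerreGaloisCohomology1997, I §2.3] -/
def cocycleOf (z : (homogeneousCochains X).cycles 1) : (resolutionX X 2).ρ.invariants :=
  ((homogeneousCochains X).iCycles 1).hom z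

variable (X) in
/-- … is killed by `d`. [cite: SerreGaloisCohomology1997, I §2.3] -/
theorem d_cocycleOf (z : (homogeneousCochains X).cycles 1) :
    (d X 2).hom (cocycleOf X z).1 = 0 := by
  have h := congrArg
    (fun f : (homogeneousCochains X).cycles 1 ⟶ (homogeneousCochains X).X 2 =>
      Subtype.val (f.hom z : (resolutionX X 3).ρ.invariants))
    ((homogeneousCochains X).iCycles_d 1 2)
  have hd := homogeneousCochains.d_apply X 1 (cocycleOf X z)
  simp only [TopModuleCat.hom_comp, ContinuousLinearMap.coe_comp, Function.comp_apply,
    TopModuleCat.hom_zero, zero_apply] at h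
  rw [← hd]
  exact h

end Cocycles

/-! ### Inflation along a quotient map -/

section Inflation

variable (φ : H →ₜ* G) (X : TopRep.{max v w} k G)

/-- Inflation on homogeneous `1`-cochains is "precompose both variables with `φ`".
[cite: SerreGaloisCohomology1997, I §2.6 (b)] -/
theorem cochainsMap_f_one_apply (σ : (homogeneousCochains X).X 1) (x y : H) :
    (((cochainsMap φ (𝟙 (res (φ : H →* G) X))).f 1).hom σ).1 x y = σ.1 (φ x) (φ y) := rfl

/-- Inflation on homogeneous `0`-cochains is "precompose with `φ`".
[cite: SerreGaloisCohomology1997, I §2.6 (b)] -/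
theorem cochainsMap_f_zero_apply (σ : (homogeneousCochains X).X 0) (x : H) :
    (((cochainsMap φ (𝟙 (res (φ : H →* G) X))).f 0).hom σ).1 x = σ.1 (φ x) := rfl

variable {φ X}

/-- THE HYPOTHESIS of the degree-one inflation theorem: every continuous crossed homomorphism
`f : H → X` for the action of `H` through `φ` (`f (a b) = f a + φ(a) • f b`) vanishes on `Ker φ`.
[cite: SerreGaloisCohomology1997, I §2.6 (b)] -/
def CrossedHomsKillKer (φ : H →ₜ* G) (X : TopRep.{max v w} k G) : Prop :=
  ∀ f : C(H, X), (∀ a b, f (a * b) = f a + X.ρ (φ a) (f b)) → ∀ n, φ n = 1 → f n = 0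

omit [IsTopologicalGroup G] in
/-- If every continuous crossed homomorphism `H → X` (for the action through `φ`) kills
`Ker φ`, then the row of an invariant `1`-cocycle of `H` is constant on the fibres of `φ`.
[cite: SerreGaloisCohomology1997, I §2.6 (b)] -/
theorem factorsThrough_row (hker : CrossedHomsKillKer φ X)
    {F : C(H, C(H, X))} (hFi : F ∈ (resolutionX (res (φ : H →* G) X) 2).ρ.invariants)
    (hFd : (d (res (φ : H →* G) X) 2).hom F = 0) :
    Function.FactorsThrough (F 1) φ := by
  intro a b hab
  have hmul : ∀ x y : H, F 1 (x * y) = F 1 x + X.ρ (φ x) (F 1 y) :=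
    fun x y => crossedHom_mul hFi hFd x y
  have hn : F 1 (a⁻¹ * b) = 0 :=
    hker (F 1) hmul (a⁻¹ * b) (by rw [map_mul, map_inv, hab, inv_mul_cancel])
  have h := hmul a (a⁻¹ * b)
  rw [mul_inv_cancel_left, hn, map_zero, add_zero] at h
  exact h.symm


section Descent

/-- Descend the row of an invariant `1`-cocycle of `H` along the quotient map `φ : H → G`.
[cite: SerreGaloisCohomology1997, I §2.6 (b)] -/
def descendRow (hq : IsQuotientMap φ) (hker : CrossedHomsKillKer φ X) {F : C(H, C(H, X))}
    (hFi : F ∈ (resolutionX (res (φ : H →* G) X) 2).ρ.invariants)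
    (hFd : (d (res (φ : H →* G) X) 2).hom F = 0) : C(G, X) :=
  (show IsQuotientMap φ.toContinuousMap from hq).lift (F 1) (factorsThrough_row hker hFi hFd)

omit [IsTopologicalGroup G] in
/-- The descended row agrees with the row on `φ`-images.
[cite: SerreGaloisCohomology1997, I §2.6 (b)] -/
theorem descendRow_apply (hq : IsQuotientMap φ) (hker : CrossedHomsKillKer φ X)
    {F : C(H, C(H, X))} (hFi : F ∈ (resolutionX (res (φ : H →* G) X) 2).ρ.invariants)
    (hFd : (d (res (φ : H →* G) X) 2).hom F = 0) (a : H) :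
    descendRow hq hker hFi hFd (φ a) = F 1 a :=
  ContinuousMap.congr_fun ((show IsQuotientMap φ.toContinuousMap from hq).lift_comp (F 1)
    (factorsThrough_row hker hFi hFd)) a

omit [IsTopologicalGroup G] in
/-- The descended row is a continuous crossed homomorphism of `G`.
[cite: SerreGaloisCohomology1997, I §2.6 (b)] -/
theorem descendRow_mul (hq : IsQuotientMap φ) (hker : CrossedHomsKillKer φ X)
    {F : C(H, C(H, X))} (hFi : F ∈ (resolutionX (res (φ : H →* G) X) 2).ρ.invariants)
    (hFd : (d (res (φ : H →* G) X) 2).hom F = 0) (x y : G) :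
    descendRow hq hker hFi hFd (x * y) =
      descendRow hq hker hFi hFd x + X.ρ x (descendRow hq hker hFi hFd y) := by
  obtain ⟨a, rfl⟩ := hq.surjective x
  obtain ⟨b, rfl⟩ := hq.surjective y
  rw [← map_mul, descendRow_apply, descendRow_apply, descendRow_apply]
  exact crossedHom_mul hFi hFd a b

/-- The inverse of inflation on `1`-cocycles, as a function: descend the row of the cocycle.
[cite: SerreGaloisCohomology1997, I §2.6 (b)] -/
def deflate (hq : IsQuotientMap φ) (hker : CrossedHomsKillKer φ X)
    (z : (homogeneousCochains (res (φ : H →* G) X)).cycles 1) : C(G, X) :=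
  descendRow hq hker (cocycleOf (res (φ : H →* G) X) z).2 (d_cocycleOf (res (φ : H →* G) X) z)

omit [IsTopologicalGroup G] in
/-- `deflate z (φ a)` is the row of `z` at `a`. [cite: SerreGaloisCohomology1997, I §2.6 (b)] -/
theorem deflate_apply (hq : IsQuotientMap φ) (hker : CrossedHomsKillKer φ X)
    (z : (homogeneousCochains (res (φ : H →* G) X)).cycles 1) (a : H) :
    deflate hq hker z (φ a) = (cocycleOf (res (φ : H →* G) X) z).1 1 a :=
  descendRow_apply hq hker (cocycleOf (res (φ : H →* G) X) z).2 (d_cocycleOf (res (φ : H →* G) X) z) a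

omit [IsTopologicalGroup G] in
/-- `deflate z` is a continuous crossed homomorphism of `G`.
[cite: SerreGaloisCohomology1997, I §2.6 (b)] -/
theorem deflate_mul (hq : IsQuotientMap φ) (hker : CrossedHomsKillKer φ X)
    (z : (homogeneousCochains (res (φ : H →* G) X)).cycles 1) (x y : G) :
    deflate hq hker z (x * y) = deflate hq hker z x + X.ρ x (deflate hq hker z y) :=
  descendRow_mul hq hker (cocycleOf (res (φ : H →* G) X) z).2 (d_cocycleOf (res (φ : H →* G) X) z) x y

omit [IsTopologicalGroup G] in
/-- `deflate` is continuous for the compact-open topologies when `H` is compact and `G` Hausdorff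
(then `φ⁻¹(K)` is compact for `K ⊆ G` compact). [cite: SerreGaloisCohomology1997, I §2.6 (b)] -/
theorem continuous_deflate [CompactSpace H] [T2Space G] (hq : IsQuotientMap φ)
    (hker : CrossedHomsKillKer φ X) : Continuous (deflate hq hker) := by
  have hrow : Continuous fun z : (homogeneousCochains (res (φ : H →* G) X)).cycles 1 =>
      (cocycleOf (res (φ : H →* G) X) z).1 1 :=
    (continuous_eval_const (1 : H)).comp
      (continuous_subtype_val.comp
        ((homogeneousCochains (res (φ : H →* G) X)).iCycles 1).hom.continuous)
  refine ContinuousMap.continuous_compactOpen.2 fun K hK U hU => ?_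
  have hK' : IsCompact (φ ⁻¹' K) := (hK.isClosed.preimage φ.continuous).isCompact
  have hopen := (ContinuousMap.isOpen_setOf_mapsTo hK' hU).preimage hrow
  convert hopen using 1
  ext z
  simp only [Set.mem_setOf_eq, Set.mem_preimage, Set.MapsTo]
  constructor
  · intro h a ha
    rw [← deflate_apply hq hker z a]
    exact h ha
  · intro h x hx
    obtain ⟨a, rfl⟩ := hq.surjective x
    rw [deflate_apply]
    exact h hx

/-- The inverse of inflation on `1`-cocycles as a continuous linear map into the homogeneous
`1`-cochains of `G`: rebuild the two-variable cochain from the descended row.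
[cite: SerreGaloisCohomology1997, I §2.6 (b)] -/
def deflateCLM [CompactSpace H] [T2Space G] (hq : IsQuotientMap φ)
    (hker : CrossedHomsKillKer φ X) :
    (homogeneousCochains (res (φ : H →* G) X)).cycles 1 →L[k] (resolutionX X 2).ρ.invariants where
  toFun z := ⟨twoOf X (deflate hq hker z), twoOf_mem_invariants (deflate_mul hq hker z)⟩
  map_add' z z' := by
    ext1
    change twoOf X (deflate hq hker (z + z')) =
      twoOf X (deflate hq hker z) + twoOf X (deflate hq hker z')
    rw [← map_add (twoOf X)]
    congr 1
    ext x
    obtain ⟨a, rfl⟩ := hq.surjective x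
    have h := map_add ((homogeneousCochains (res (φ : H →* G) X)).iCycles 1).hom z z'
    rw [ContinuousMap.add_apply, deflate_apply, deflate_apply, deflate_apply]
    unfold cocycleOf
    rw [h]
    rfl
  map_smul' c z := by
    ext1
    change twoOf X (deflate hq hker (c • z)) = c • twoOf X (deflate hq hker z)
    rw [← map_smul (twoOf X)]
    congr 1
    ext x
    obtain ⟨a, rfl⟩ := hq.surjective x
    have h := map_smul ((homogeneousCochains (res (φ : H →* G) X)).iCycles 1).hom c z
    rw [ContinuousMap.smul_apply, deflate_apply, deflate_apply]
    unfold cocycleOf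
    rw [h]
    rfl
  cont := continuous_induced_rng.2 ((twoOf X).continuous.comp (continuous_deflate hq hker))

/-- Value of `deflateCLM`. [cite: SerreGaloisCohomology1997, I §2.6 (b)] -/
theorem deflateCLM_apply_coe [CompactSpace H] [T2Space G] (hq : IsQuotientMap φ)
    (hker : CrossedHomsKillKer φ X) (z : (homogeneousCochains (res (φ : H →* G) X)).cycles 1) :
    (deflateCLM hq hker z).1 = twoOf X (deflate hq hker z) := rfl

end Descent

/-! ### The isomorphism on `1`-cocycles and on `H¹` -/

section Main

variable (φ X) in
/-- The inflation cochain map `C•(G, X) → C•(H, X|_H)` of Mathlib (`cochainsMap φ (𝟙 _)`).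
[cite: SerreGaloisCohomology1997, I §2.6 (b)] -/
abbrev infl : homogeneousCochains X ⟶ homogeneousCochains (res (φ : H →* G) X) :=
  cochainsMap φ (𝟙 (res (φ : H →* G) X))

/-- The descent `Z¹(H, X|_H) → C¹(G, X)` as a morphism of `TopModuleCat k`.
[cite: SerreGaloisCohomology1997, I §2.6 (b)] -/
def deflateHom [CompactSpace H] [T2Space G] (hq : IsQuotientMap φ)
    (hker : CrossedHomsKillKer φ X) :
    (homogeneousCochains (res (φ : H →* G) X)).cycles 1 ⟶ (homogeneousCochains X).X 1 :=
  ConcreteCategory.ofHom (C := TopModuleCat k) (deflateCLM hq hker)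

/-- The descended cochains are cocycles: `deflateHom ≫ d = 0`.
[cite: SerreGaloisCohomology1997, I §2.6 (b)] -/
theorem deflateHom_comp_d [CompactSpace H] [T2Space G] (hq : IsQuotientMap φ)
    (hker : CrossedHomsKillKer φ X) :
    deflateHom hq hker ≫ (homogeneousCochains X).d 1 2 = 0 := by
  refine ConcreteCategory.hom_ext _ _ fun z => Subtype.ext ?_
  have hd := homogeneousCochains.d_apply X 1 (deflateCLM hq hker z)
  exact hd.trans (d_twoOf (deflate hq hker z))

/-- The descent `Z¹(H, X|_H) → Z¹(G, X)` (the inverse of inflation on `1`-cocycles).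
[cite: SerreGaloisCohomology1997, I §2.6 (b)] -/
def deflateCycles [CompactSpace H] [T2Space G] (hq : IsQuotientMap φ)
    (hker : CrossedHomsKillKer φ X) :
    (homogeneousCochains (res (φ : H →* G) X)).cycles 1 ⟶ (homogeneousCochains X).cycles 1 :=
  (homogeneousCochains X).liftCycles (deflateHom hq hker) 2 (CochainComplex.next ℕ 1)
    (deflateHom_comp_d hq hker)

/-- On `1`-cocycles of `H`, the inflated `1`-cocycle of `G` underlying `cyclesMap w` is
`(x, y) ↦ W (φ x) (φ y)`. [cite: SerreGaloisCohomology1997, I §2.6 (b)] -/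
theorem cocycleOf_cyclesMap (w : (homogeneousCochains X).cycles 1) (x y : H) :
    (cocycleOf (res (φ : H →* G) X) (HomologicalComplex.cyclesMap (infl φ X) 1 w)).1 x y =
      (cocycleOf X w).1 (φ x) (φ y) := by
  have h := congrArg (fun f : (homogeneousCochains X).cycles 1 ⟶
      (homogeneousCochains (res (φ : H →* G) X)).X 1 =>
        Subtype.val (f.hom w : (resolutionX (res (φ : H →* G) X) 2).ρ.invariants) x y)
    (HomologicalComplex.cyclesMap_i (infl φ X) 1)
  exact h

/-- `deflateCycles ≫ cyclesMap = 𝟙`: inflating the descent gives back the cocycle of `H`.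
[cite: SerreGaloisCohomology1997, I §2.6 (b)] -/
theorem deflateCycles_comp_cyclesMap [CompactSpace H] [T2Space G] (hq : IsQuotientMap φ)
    (hker : CrossedHomsKillKer φ X) :
    deflateCycles hq hker ≫ HomologicalComplex.cyclesMap (infl φ X) 1 = 𝟙 _ := by
  rw [← cancel_mono ((homogeneousCochains (res (φ : H →* G) X)).iCycles 1), Category.assoc,
    HomologicalComplex.cyclesMap_i, Category.id_comp, ← Category.assoc, deflateCycles,
    HomologicalComplex.liftCycles_i]
  refine ConcreteCategory.hom_ext _ _ fun z => Subtype.ext ?_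
  ext x y
  change twoOf X (deflate hq hker z) (φ x) (φ y) = (cocycleOf (res (φ : H →* G) X) z).1 x y
  rw [twoOf_apply, deflate_apply, deflate_apply,
    cocycle_eq (d_cocycleOf (res (φ : H →* G) X) z) x y]

/-- `cyclesMap ≫ deflateCycles = 𝟙`: descending an inflated cocycle gives back the cocycle of `G`.
[cite: SerreGaloisCohomology1997, I §2.6 (b)] -/
theorem cyclesMap_comp_deflateCycles [CompactSpace H] [T2Space G] (hq : IsQuotientMap φ)
    (hker : CrossedHomsKillKer φ X) :
    HomologicalComplex.cyclesMap (infl φ X) 1 ≫ deflateCycles hq hker = 𝟙 _ := by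
  rw [← cancel_mono ((homogeneousCochains X).iCycles 1), Category.assoc, deflateCycles,
    HomologicalComplex.liftCycles_i, Category.id_comp]
  refine ConcreteCategory.hom_ext _ _ fun w => Subtype.ext ?_
  ext x y
  obtain ⟨a, rfl⟩ := hq.surjective x
  obtain ⟨b, rfl⟩ := hq.surjective y
  change twoOf X (deflate hq hker (HomologicalComplex.cyclesMap (infl φ X) 1 w)) (φ a) (φ b) =
    (cocycleOf X w).1 (φ a) (φ b)
  rw [twoOf_apply, deflate_apply, deflate_apply, cocycleOf_cyclesMap, cocycleOf_cyclesMap, map_one,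
    cocycle_eq (d_cocycleOf X w) (φ a) (φ b)]

/-- **Inflation is an isomorphism on `1`-cocycles** (in `TopModuleCat k`), under
`CrossedHomsKillKer`. [cite: SerreGaloisCohomology1997, I §2.6 (b)] -/
theorem isIso_cyclesMap_one [CompactSpace H] [T2Space G] (hq : IsQuotientMap φ)
    (hker : CrossedHomsKillKer φ X) : IsIso (HomologicalComplex.cyclesMap (infl φ X) 1) :=
  ⟨deflateCycles hq hker, cyclesMap_comp_deflateCycles hq hker, deflateCycles_comp_cyclesMap hq hker⟩

/-- Inflation is SURJECTIVE on homogeneous `0`-cochains (`f ↦ f ∘ φ` onto the invariant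
elements of `C(H, X)`), for `φ` a quotient map. [cite: SerreGaloisCohomology1997, I §2.6 (b)] -/
theorem f_zero_surjective (hq : IsQuotientMap φ) : Function.Surjective ((infl φ X).f 0).hom := by
  intro σ'
  -- the invariant `0`-cochain `σ'` of `H` is `a ↦ φ(a) • v`, `v := σ' 1`
  have hσ' : ∀ a : H, σ'.1 a = X.ρ (φ a) (σ'.1 1) := by
    intro a
    have h := congrArg (fun f : C(H, X) => f a) (σ'.2 a)
    simp only [coind₁_apply_apply, inv_mul_cancel, ContRepresentation.restrict_apply_apply,
      MonoidHom.coe_coe] at h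
    exact h.symm
  have hfac : Function.FactorsThrough σ'.1 φ := by
    intro a b hab
    rw [hσ' a, hσ' b, hab]
  let f : C(G, X) := (show IsQuotientMap φ.toContinuousMap from hq).lift σ'.1 hfac
  have hf : ∀ a : H, f (φ a) = σ'.1 a := fun a =>
    ContinuousMap.congr_fun ((show IsQuotientMap φ.toContinuousMap from hq).lift_comp σ'.1 hfac) a
  have hfmem : f ∈ (resolutionX X 1).ρ.invariants := by
    intro g
    ext x
    obtain ⟨a, rfl⟩ := hq.surjective g
    obtain ⟨b, rfl⟩ := hq.surjective x
    simp only [coind₁_apply_apply]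
    rw [← map_inv, ← map_mul, hf, hf, hσ' (a⁻¹ * b), hσ' b, ← ContinuousLinearMap.comp_apply,
      ← ContinuousLinearMap.mul_def, ← map_mul, ← map_mul, mul_inv_cancel_left]
  refine ⟨⟨f, hfmem⟩, Subtype.ext ?_⟩
  ext a
  exact hf a

/-- **Degree-one inflation is an isomorphism.**  Let `φ : H → G` be a quotient map of topological
groups with `H` compact and `G` Hausdorff, and `X` a topological `k[G]`-module such that every
continuous crossed homomorphism `H → X` (for the action through `φ`) vanishes on `Ker φ`.  Then the
inflation map `H¹(G, X) → H¹(H, X|_H)` on Mathlib's continuous cohomology is an ISOMORPHISM in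
`TopModuleCat k`. [cite: SerreGaloisCohomology1997, I §2.6 (b)] -/
theorem isIso_map_one_of_crossedHomsKillKer [CompactSpace H] [T2Space G]
    (hq : IsQuotientMap φ) (hker : CrossedHomsKillKer φ X) :
    IsIso (ContinuousCohomology.map φ (𝟙 (res (φ : H →* G) X)) 1) := by
  have h1 := isIso_cyclesMap_one hq hker
  have hprev : (ComplexShape.up ℕ).prev 1 = 0 := CochainComplex.prev_nat_succ 0
  have h2 : Epi ((infl φ X).f ((ComplexShape.up ℕ).prev 1)) := by
    rw [hprev]
    exact ConcreteCategory.epi_of_surjective _ (f_zero_surjective hq)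
  exact ShortComplex.isIso_homologyMap_of_isIso_cyclesMap_of_epi h1 h2

end Main

end Inflation

end ContinuousCohomology
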